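import Literature.AlgebraicTopology.SingularHomology.RelativeHomotopyInvariance
import Literature.AlgebraicTopology.SingularHomology.TripleSequence
import Literature.AlgebraicTopology.SingularHomology.ExcisionMayerVietoris
import Literature.AlgebraicTopology.Homotopy.StrongDeformationRetract
import HarnessLib

/-!
# A deformation retraction induces isomorphisms on relative homology

A. Hatcher, *Algebraic Topology* (2002), §2.1: relative homology is functorial in maps of pairs
and homotopic maps of pairs induce the same homomorphism (Prop. 2.19, p. 118; proved in the tree,
`Literature.AlgebraicTopology.SingularHomology.relativeSingularHomology.map_eq_of_homotopic_holds`),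
so that a homotopy equivalence of pairs induces isomorphisms; in particular (Ch. 0, p. 2, and the
use made of it throughout §2.1, e.g. Example 2.17 / Prop. 2.22) **if `A` is a deformation retract
of `S` by a deformation fixing `A` pointwise, and `V ⊆ A`, then `Hₙ(A, V) → Hₙ(S, V)` is an
isomorphism for all `n`**: the end `r = H₁ : S → A` of the deformation is a map of pairs
`(S, V) → (A, V)` with `r ∘ i = 𝟙` and `i ∘ r = H₁ ≃ H₀ = 𝟙` through maps of pairs
`(S, V) → (S, V)` (the deformation fixes `V ⊆ A`).

This is the form in which Milnor's Thm. 3.14 (*`V ∪ D_L` is a deformation retract of `W`*, the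
tree's fact `Literature.Topology.FourManifolds.Cobordism.Milnor1965_deformationRetract_leftHandDiscs`)
enters the homology computation of Cor. 3.15; the deformation retraction is the tree's
`Literature.AlgebraicTopology.Homotopy.IsStrongDeformationRetractOf` (`StrongDeformationRetract.lean`).

## Main results

(The results taking `h : IsStrongDeformationRetractOf A S` are declared as dot-notation extensions
of that Literature structure, in its namespace `Literature.AlgebraicTopology.Homotopy`.)

* `Literature.AlgebraicTopology.Homotopy.IsStrongDeformationRetractOf.retraction`: the end
  map `r : S → A` of the deformation, with `r ∘ i = 𝟙` (`retraction_comp_inclusion`) and a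
  homotopy of pairs `𝟙 ≃ i ∘ r` (`homotopyInclusionCompRetraction`);
* `Literature.AlgebraicTopology.Homotopy.IsStrongDeformationRetractOf.isIso_map_inclusion`:
  `Hₙ(A, V) → Hₙ(S, V)` is an isomorphism for `V ⊆ A ⊆ S`, `A` a strong deformation retract of
  `S`;
* `Literature.AlgebraicTopology.Homotopy.IsStrongDeformationRetractOf.isZero_relativeSingularHomology`:
  `Hₙ(S, A) = 0` for `A ⊆ S` a strong deformation retract.

## References

* A. Hatcher, *Algebraic Topology*, CUP 2002, Ch. 0, p. 2 (deformation retractions) and §2.1,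
  Prop. 2.19 (p. 118). [HatcherAT2002]
-/

noncomputable section

open CategoryTheory Limits Set unitInterval
open Literature.AlgebraicTopology.Homotopy

universe u v

namespace Literature.AlgebraicTopology.SingularHomology

variable (R : Type v) [CommRing R] (M : Type v) [AddCommGroup M] [Module R M]
variable {X : Type u} [TopologicalSpace X]

variable {A S V : Set X}

/-- **The retraction `r = H₁ : S → A`** at the end of a strong deformation retraction of `S` onto
`A ⊆ S` (Hatcher 2002, Ch. 0, p. 2: *"`f₁(X) = A`"*), as a continuous map of subtypes.
[cite: HatcherAT2002, Ch. 0, p. 2] -/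
def _root_.Literature.AlgebraicTopology.Homotopy.IsStrongDeformationRetractOf.retraction
    (h : IsStrongDeformationRetractOf A S) : C(↥S, ↥A) :=
  ⟨fun x => ⟨(h.choose (1, x) : X), h.choose_spec.2.1 x⟩,
    (continuous_subtype_val.comp (h.choose.continuous.comp (Continuous.prodMk_right 1))).subtype_mk _⟩

/-- The retraction is the end of the (chosen) deformation: `r x = H (1, x)` in `X`. [folklore] -/
@[simp]
theorem _root_.Literature.AlgebraicTopology.Homotopy.IsStrongDeformationRetractOf.coe_retraction_apply
    (h : IsStrongDeformationRetractOf A S) (x : ↥S) :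
    (h.retraction x : X) = h.choose (1, x) :=
  rfl

/-- **`r ∘ i = 𝟙`**: the retraction fixes `A` (the deformation fixes `A` pointwise).
[cite: HatcherAT2002, Ch. 0, p. 2] -/
theorem _root_.Literature.AlgebraicTopology.Homotopy.IsStrongDeformationRetractOf.retraction_comp_inclusion
    (h : IsStrongDeformationRetractOf A S) (hAS : A ⊆ S) :
    h.retraction.comp (subsetInclusion hAS) = ContinuousMap.id ↥A := by
  ext y
  change ((h.choose (1, ⟨y, hAS y.2⟩) : ↥S) : X) = y
  rw [h.choose_spec.2.2 1 ⟨y, hAS y.2⟩ y.2]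

/-- **`𝟙 ≃ i ∘ r`**: the deformation itself is a homotopy from the identity of `S` to the
retraction followed by the inclusion. [cite: HatcherAT2002, Ch. 0, p. 2] -/
def _root_.Literature.AlgebraicTopology.Homotopy.IsStrongDeformationRetractOf.homotopyInclusionCompRetraction
    (h : IsStrongDeformationRetractOf A S) (hAS : A ⊆ S) :
    ContinuousMap.Homotopy (ContinuousMap.id ↥S) ((subsetInclusion hAS).comp h.retraction) where
  toFun := h.choose
  continuous_toFun := h.choose.continuous
  map_zero_left x := h.choose_spec.1 x
  map_one_left _ := Subtype.ext rfl

/-- The deformation is a homotopy *of pairs* `(S, V) → (S, V)` for every `V ⊆ A` (it fixes `A`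
pointwise). [cite: HatcherAT2002, Ch. 0, p. 2] -/
theorem _root_.Literature.AlgebraicTopology.Homotopy.IsStrongDeformationRetractOf.homotopyInclusionCompRetraction_apply_mem
    (h : IsStrongDeformationRetractOf A S)
    (hAS : A ⊆ S) (hVA : V ⊆ A) (tx : I × ↥S) (htx : tx.2 ∈ (Subtype.val ⁻¹' V : Set ↥S)) :
    h.homotopyInclusionCompRetraction hAS tx ∈ (Subtype.val ⁻¹' V : Set ↥S) := by
  change ((h.choose (tx.1, tx.2) : ↥S) : X) ∈ V
  rw [h.choose_spec.2.2 tx.1 tx.2 (hVA htx)]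
  exact htx

/-- The inclusion `A ⊆ S` is a map of pairs `(A, V) → (S, V)`. [folklore] -/
theorem mapsTo_subsetInclusion (hAS : A ⊆ S) (V : Set X) :
    MapsTo (subsetInclusion hAS) (Subtype.val ⁻¹' V : Set ↥A) (Subtype.val ⁻¹' V : Set ↥S) :=
  fun _ hx => hx

/-- The retraction is a map of pairs `(S, V) → (A, V)` for `V ⊆ A`. [folklore] -/
theorem _root_.Literature.AlgebraicTopology.Homotopy.IsStrongDeformationRetractOf.mapsTo_retraction
    (h : IsStrongDeformationRetractOf A S) (hVA : V ⊆ A) :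
    MapsTo h.retraction (Subtype.val ⁻¹' V : Set ↥S) (Subtype.val ⁻¹' V : Set ↥A) := by
  intro x hx
  change ((h.choose (1, x) : ↥S) : X) ∈ V
  rw [h.choose_spec.2.2 1 x (hVA hx)]
  exact hx

/-- `i⁎ ≫ r⁎ = 𝟙` on `Hₙ(A, V)`. [cite: HatcherAT2002, §2.1, Prop. 2.19 (p. 118)] -/
theorem _root_.Literature.AlgebraicTopology.Homotopy.IsStrongDeformationRetractOf.map_inclusion_comp_map_retraction
    (h : IsStrongDeformationRetractOf A S) (hAS : A ⊆ S)
    (hVA : V ⊆ A) (n : ℕ) :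
    relativeSingularHomology.map R M (subsetInclusion hAS) (mapsTo_subsetInclusion hAS V) n ≫
      relativeSingularHomology.map R M h.retraction (h.mapsTo_retraction hVA) n = 𝟙 _ := by
  rw [← relativeSingularHomology.map_comp, relativeSingularHomology.map_congr R M
    (h.retraction_comp_inclusion hAS) _ (mapsTo_id _), relativeSingularHomology.map_id]

/-- `r⁎ ≫ i⁎ = 𝟙` on `Hₙ(S, V)` (homotopy invariance for pairs, Prop. 2.19).
[cite: HatcherAT2002, §2.1, Prop. 2.19 (p. 118)] -/
theorem _root_.Literature.AlgebraicTopology.Homotopy.IsStrongDeformationRetractOf.map_retraction_comp_map_inclusion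
    (h : IsStrongDeformationRetractOf A S) (hAS : A ⊆ S)
    (hVA : V ⊆ A) (n : ℕ) :
    relativeSingularHomology.map R M h.retraction (h.mapsTo_retraction hVA) n ≫
      relativeSingularHomology.map R M (subsetInclusion hAS) (mapsTo_subsetInclusion hAS V) n =
        𝟙 _ := by
  rw [← relativeSingularHomology.map_comp, ← relativeSingularHomology.map_eq_of_homotopic_holds R M
    (mapsTo_id _) _ (h.homotopyInclusionCompRetraction hAS)
    (h.homotopyInclusionCompRetraction_apply_mem hAS hVA) n, relativeSingularHomology.map_id]

/-- **A strong deformation retraction induces isomorphisms `Hₙ(A, V) ≅ Hₙ(S, V)`** for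
`V ⊆ A ⊆ S` (Hatcher 2002, §2.1: the inclusion of pairs `(A, V) → (S, V)` is a homotopy
equivalence of pairs, with inverse the retraction, Prop. 2.19).
[cite: HatcherAT2002, §2.1, Prop. 2.19 (p. 118), with Ch. 0, p. 2] -/
theorem _root_.Literature.AlgebraicTopology.Homotopy.IsStrongDeformationRetractOf.isIso_map_inclusion
    (h : IsStrongDeformationRetractOf A S) (hAS : A ⊆ S) (hVA : V ⊆ A)
    (n : ℕ) :
    IsIso (relativeSingularHomology.map R M (subsetInclusion hAS) (mapsTo_subsetInclusion hAS V) n) :=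
  ⟨⟨relativeSingularHomology.map R M h.retraction (h.mapsTo_retraction hVA) n,
    h.map_inclusion_comp_map_retraction R M hAS hVA n, h.map_retraction_comp_map_inclusion R M hAS hVA n⟩⟩

/-- The isomorphism `Hₙ(A, V) ≅ Hₙ(S, V)` of `isIso_map_inclusion`. [cite: HatcherAT2002, §2.1, Prop. 2.19 (p. 118), with Ch. 0, p. 2] -/
def _root_.Literature.AlgebraicTopology.Homotopy.IsStrongDeformationRetractOf.relativeSingularHomologyIso
    (h : IsStrongDeformationRetractOf A S) (hAS : A ⊆ S) (hVA : V ⊆ A)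
    (n : ℕ) :
    relativeSingularHomology R M (↥A) (Subtype.val ⁻¹' V) n ≅
      relativeSingularHomology R M (↥S) (Subtype.val ⁻¹' V) n :=
  haveI := h.isIso_map_inclusion R M hAS hVA n
  asIso (relativeSingularHomology.map R M (subsetInclusion hAS) (mapsTo_subsetInclusion hAS V) n)

/-- **`Hₙ(S, A) = 0` if `A ⊆ S` is a strong deformation retract** (`Hₙ(A, A) = 0 ≅ Hₙ(S, A)`).
[cite: HatcherAT2002, §2.1, Prop. 2.19 (p. 118), with Ch. 0, p. 2] -/
theorem _root_.Literature.AlgebraicTopology.Homotopy.IsStrongDeformationRetractOf.isZero_relativeSingularHomology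
    (h : IsStrongDeformationRetractOf A S) (hAS : A ⊆ S)
    (n : ℕ) : IsZero (relativeSingularHomology R M (↥S) (Subtype.val ⁻¹' A) n) :=
  (relativeSingularHomology.isZero_preimage_self R M A n).of_iso
    (h.relativeSingularHomologyIso R M hAS subset_rfl n).symm


end Literature.AlgebraicTopology.SingularHomology
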